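import Summits.ValiantsHypothesis.ValiantsHypothesis.Theorems.NewtonUnitEquationsTwoProductsRankOneFourLawCount
import Summits.ValiantsHypothesis.ValiantsHypothesis.Theorems.NewtonUnitEquationsTwoProductsFormalLogLinearisationShiftRankCell
import HarnessLib

/-!
# Route NewtonUnitEquations — crux `TwoProducts` (stmt-ValiantsHypothesis-5906), line `relation_ladder`, rung R6b (three-term
# rank one, shape `α = β + γ`): the FREE LIFT — `RankOneThreeLaw`, UNCONDITIONAL — part 1/6 — the free substitution `Y_α ↦ Y_β Y_γ`, its fibres and the multinomial regrouping (Parts T2–T3)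

(T2) three distinct indices `ThreeIdx` and the FREE substitution `frM` (`Y_a ↦ Y_b Y_c`, other letters unchanged), coordinates of toric images;
(T3) the three special coordinates, reduced exponents `xhat`, the fibre parametrisation `Lof`/`KR` (letter count DROPS by `k` along the fibre),
the slice normaliser `Pfac` and the multinomial regrouping `multinomial_Lof_div`, fibre sums `coeff_phiT_frM`.

val-idea-8 g3 (ideator; lens decomp), 2026-08-28. Companion of the R6 module (shape `α + β = γ + δ`, Segre lift). New ingredient: the
relation is INHOMOGENEOUS, so the fibres of the lift `Y_α ↦ Y_β Y_γ` have VARYING letter count and the slice sums are no longer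
binomial-exponential sums of bounded width; they carry the extra factor `C(λ(ν) + b - 1 - k, b - k)` with `λ` an ADDITIVE form, which still has
finite SHIFT RANK — so val-lit-p3's general strict-pencil-minimiser count for finite shift rank (`…FormalLogLinearisation.ShiftRank.pencilCount`,
LANDED p620579) applies BY NAME.

PORT NOTE (val-lit-p3 g15, prover seat, helper mode `--supports stmt-ValiantsHypothesis-5906 --as helper`, no stub credit claimed;
desk RULING #279 (c)): part 1/6 of a VERBATIM Theorems-side port of val-idea-8 g3's sorry-free module
`Cruxes/TwoProducts/Lines/relation_ladder_R6b.lean` (tree @988ccfe3a7f4; file sha256 da7520fdfde8796f…; 1 661 lines; `lean check` rc 0,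
0 sorries) into files of ≤ 400 lines, following the R6 port (`…RankOneFourLaw{Toric,Fibres,Slice,Planar,Weights,Count}`, p11 g1 / p3 g14).
ALL mathematics and ALL proofs below are val-idea-8 g3's (engine memo `Cruxes/TwoProducts/Lines/relation_ladder_R6_engine.md` rev 3 §7′,
card `Lines/relation_ladder.md` v14). The port changes only: (i) the file split and the import chain; (ii) the generic toolkit that the source
re-declares VERBATIM from the R6 module (`phiT/piT` family, `piT_apply`, `ofFun`, `multinomial_univ`, `tab`, `sgn`, `binChar` + lemmas,
`toolBound_mono`, the toric Lemma A `toric_minLog` with `coeff_zero_phiT_lin/coeff_zero_one_add_phiT_lin/phiT_liftG/phiT_logTrunc`,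
`RankOneCoincidences`, `rankOneCoincidences_of_permType`, `msetT_apply_eq_zero`, `idxOf`, `enum_idxOf`, `rW`, `lwt_single`, `lwt_piT`) is NOT
re-declared but IMPORTED from the landed R6 port (`…RankOneFourLaw*`, namespace `…PermutationType`, identical texts), so every such name below
resolves to the landed declaration; (iii) `set_option linter.deprecated false` dropped; (iv) one-line docstrings on API lemmas required by the
tree's docstring lint; (v) in part 6/6 the parameter-free `def RankOneThreeLaw : Prop` is NOT declared (the gate relocates such defs, cf. the R6
port delta p622844) — the law is stated by its LITERAL body as `rankOneThreeLaw_proof`. Namespace = the author's (`…PermutationType.R6b`).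
Nothing here closes the line's residual, the crux `TwoProducts` (5906) or `VP ≠ VNP`; no summit statement is proved.

Cut table (source line ranges of `Lines/relation_ladder_R6b.lean` @988ccfe3a7f4): part 1 `…Free` = l. 144–443 (T2–T3: `ThreeIdx`, the free
substitution `frM`, fibres `Lof/KR`, `Pfac`, `multinomial_Lof_div`, `coeff_phiT_frM`); part 2 `…Slice` = l. 444–778 (T4: slice functions `Fsl`,
THE COEFFICIENT THEOREM `coeff_free_logTrunc` + exceptional exponents, support criterion); part 3 `…Shift` = l. 780–947 (T5: finite shift rank
`Fsl_shift`); part 4 `…Planar` = l. 1002–1284 (T7: `RelData`, free lift `GT`, injectivity from rank-one coincidences, letter weights); part 5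
`…Count` = l. 1286–1527 (T8: per visible point `sliceMin_of_visible`, `sliceCount` via `ShiftRank.pencilCount`, `RelData.count`); part 6 `…Law` =
l. 1529–1655 (arithmetic `arith_R6b`, the law `rankOneThreeLaw_proof`). Dropped as duplicates of the landed R6 port: l. 32–142, 254–258, 348–355,
450–454, 460–469, 949–1000, 1011–1038, 1064–1070, 1224–1225, 1231–1247, 1401–1410; l. 1605–1613 (`def RankOneThreeLaw`) replaced by the literal body.

Honest scope (the author's): the shape `2β = α + γ` (R6c) and coincidence rank `≥ 2` (R7) are NOT covered here and go to the residual of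
skeleton v15. Nothing here moves VP ≠ VNP; `TwoProducts` (5906) stays OPEN. [folklore]
-/

noncomputable section

-- Sub = Summit single-conjunct layout: the duplicated namespace component is mandated by the tree.
set_option linter.dupNamespace false
set_option linter.unusedSimpArgs false
set_option linter.unusedSectionVars false

namespace Summit.ValiantsHypothesis.ValiantsHypothesis.Theorems.NewtonUnitEquations.TwoProducts.PermutationType
namespace R6b
open scoped BigOperators
open MvPolynomial

variable {σ : Type*} [Fintype σ] [DecidableEq σ]

/-! ## Part T2: three distinct indices and the FREE substitution `Y_a ↦ Y_b Y_c` (letter relation `α = β + γ`) -/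

/-- Three distinct indices (of the relation letters `α = β + γ`). [folklore] -/
structure ThreeIdx (σ : Type*) where
  /-- index of `α` (idle upstairs) -/
  a : σ
  /-- index of `β` -/
  b : σ
  /-- index of `γ` (the slice coordinate) -/
  c : σ
  hab : a ≠ b
  hac : a ≠ c
  hbc : b ≠ c

variable (I : ThreeIdx σ)

/-- The free substitution on letters: `α ↦ β + γ`, all other letters unchanged. [folklore] -/
def frM (i : σ) : σ →₀ ℕ :=
  if i = I.a then Finsupp.single I.b 1 + Finsupp.single I.c 1 else Finsupp.single i 1

omit [Fintype σ] in
/-- The free substitution at `α`. [folklore] -/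
theorem frM_a : frM I I.a = Finsupp.single I.b 1 + Finsupp.single I.c 1 := by
  unfold frM; rw [if_pos rfl]

omit [Fintype σ] in
/-- The free substitution elsewhere. [folklore] -/
theorem frM_other (i : σ) (ha : i ≠ I.a) : frM I i = Finsupp.single i 1 := by
  unfold frM; rw [if_neg ha]

omit [Fintype σ] in
/-- Every `frM i` is nonzero. [folklore] -/
theorem frM_ne_zero (i : σ) : frM I i ≠ 0 := by
  unfold frM
  split_ifs <;> intro h
  · have := DFunLike.congr_fun h I.b; simp [Finsupp.single_apply, I.hbc, I.hbc.symm] at this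
  · have := DFunLike.congr_fun h i; simp at this

/-- The `a`-coordinate of a toric image vanishes. [folklore] -/
theorem piT_frM_a (L : σ →₀ ℕ) : piT (frM I) L I.a = 0 := by
  have F := And.intro I.hab (And.intro I.hac I.hbc)
  rw [piT_apply]
  refine Finset.sum_eq_zero fun i _ => ?_
  unfold frM
  split_ifs with h1 <;>
    simp [Finsupp.single_apply, h1, F.1, F.2.1, F.2.2, F.1.symm, F.2.1.symm, F.2.2.symm]

/-- The `b`-coordinate of a toric image: `#α + #β`. [folklore] -/
theorem piT_frM_b (L : σ →₀ ℕ) : piT (frM I) L I.b = L I.a + L I.b := by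
  have F := And.intro I.hab (And.intro I.hac I.hbc)
  rw [piT_apply]
  have key : ∀ i, L i * (frM I i) I.b = (if i = I.a then L i else 0) + (if i = I.b then L i else 0) := by
    intro i
    unfold frM
    split_ifs with h1 h2 <;>
      simp [Finsupp.single_apply, F.1, F.2.1, F.2.2, F.1.symm, F.2.1.symm, F.2.2.symm] <;> simp_all
  simp only [key, Finset.sum_add_distrib, Finset.sum_ite_eq', Finset.mem_univ, if_true]

/-- The `c`-coordinate of a toric image: `#α + #γ`. [folklore] -/
theorem piT_frM_c (L : σ →₀ ℕ) : piT (frM I) L I.c = L I.a + L I.c := by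
  have F := And.intro I.hab (And.intro I.hac I.hbc)
  rw [piT_apply]
  have key : ∀ i, L i * (frM I i) I.c = (if i = I.a then L i else 0) + (if i = I.c then L i else 0) := by
    intro i
    unfold frM
    split_ifs with h1 h2 <;>
      simp [Finsupp.single_apply, F.1, F.2.1, F.2.2, F.1.symm, F.2.1.symm, F.2.2.symm] <;> simp_all
  simp only [key, Finset.sum_add_distrib, Finset.sum_ite_eq', Finset.mem_univ, if_true]

/-- Other coordinates of a toric image are unchanged. [folklore] -/
theorem piT_frM_other (L : σ →₀ ℕ) (j : σ) (ha : j ≠ I.a) (hb : j ≠ I.b) (hc : j ≠ I.c) : piT (frM I) L j = L j := by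
  have F := And.intro I.hab (And.intro I.hac I.hbc)
  rw [piT_apply]
  have key : ∀ i, L i * (frM I i) j = (if i = j then L i else 0) := by
    intro i
    unfold frM
    split_ifs with h1 h2 <;>
      simp [Finsupp.single_apply, ha, hb, hc, Ne.symm ha, Ne.symm hb, Ne.symm hc,
        F.1, F.2.1, F.2.2, F.1.symm, F.2.1.symm, F.2.2.symm] <;> simp_all
  simp only [key]
  rw [Finset.sum_ite_eq']; simp

/-! ## Part T3: the three special coordinates, reduced exponents, and the fibres of the free substitution -/

/-- The three relation indices as a finset. [folklore] -/
def threeSet : Finset σ := {I.a, I.b, I.c}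

/-- The remaining indices. [folklore] -/
def rest : Finset σ := Finset.univ \ threeSet I

/-- Membership in the remaining indices. [folklore] -/
theorem mem_rest (j : σ) : j ∈ rest I ↔ j ≠ I.a ∧ j ≠ I.b ∧ j ≠ I.c := by
  classical
  unfold rest threeSet
  simp only [Finset.mem_sdiff, Finset.mem_univ, true_and, Finset.mem_insert, Finset.mem_singleton, not_or]

/-- Splitting a product over `σ` into the three relation coordinates and the rest. [folklore] -/
theorem prod_three_split {β : Type*} [CommMonoid β] (f : σ → β) :
    ∏ j, f j = (∏ j ∈ rest I, f j) * (f I.a * (f I.b * f I.c)) := by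
  classical
  unfold rest threeSet
  rw [← Finset.prod_sdiff (Finset.subset_univ ({I.a, I.b, I.c} : Finset σ))]
  congr 1
  rw [Finset.prod_insert (by simp [I.hab, I.hac]), Finset.prod_pair I.hbc]

/-- Splitting a sum over `σ` into the three relation coordinates and the rest. [folklore] -/
theorem sum_three_split {β : Type*} [AddCommMonoid β] (f : σ → β) :
    ∑ j, f j = (∑ j ∈ rest I, f j) + (f I.a + (f I.b + f I.c)) := by
  classical
  unfold rest threeSet
  rw [← Finset.sum_sdiff (Finset.subset_univ ({I.a, I.b, I.c} : Finset σ))]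
  congr 1
  rw [Finset.sum_insert (by simp [I.hab, I.hac]), Finset.sum_pair I.hbc]


/-- The reduced exponent `x̂`: the coordinates `a, c` set to zero. [folklore] -/
def xhat (x : σ →₀ ℕ) : σ →₀ ℕ := ofFun fun j => if j = I.a ∨ j = I.c then 0 else x j

/-- The reduced exponent at `a`. [folklore] -/
theorem xhat_a (x : σ →₀ ℕ) : xhat I x I.a = 0 := by
  classical simp [xhat]

/-- The reduced exponent at `b`. [folklore] -/
theorem xhat_b (x : σ →₀ ℕ) : xhat I x I.b = x I.b := by
  classical simp [xhat, I.hab.symm, I.hbc]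

/-- The reduced exponent at `c`. [folklore] -/
theorem xhat_c (x : σ →₀ ℕ) : xhat I x I.c = 0 := by
  classical simp [xhat]

/-- The reduced exponent elsewhere. [folklore] -/
theorem xhat_other (x : σ →₀ ℕ) (j : σ) (ha : j ≠ I.a) (hc : j ≠ I.c) : xhat I x j = x j := by
  classical simp [xhat, ha, hc]

/-- The letter multiset in the fibre of the free substitution over `x` with `#α = k`:
`#α = k, #β = x b - k, #γ = x c - k`, other letters as in `x`. [folklore] -/
def Lof (x : σ →₀ ℕ) (k : ℕ) : σ →₀ ℕ :=
  ofFun fun j => if j = I.a then k else if j = I.b then x I.b - k else if j = I.c then x I.c - k else x j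

/-- The fibre element at `a`. [folklore] -/
theorem Lof_a (x : σ →₀ ℕ) (k : ℕ) : Lof I x k I.a = k := by
  classical simp [Lof]

/-- The fibre element at `b`. [folklore] -/
theorem Lof_b (x : σ →₀ ℕ) (k : ℕ) : Lof I x k I.b = x I.b - k := by
  classical simp [Lof, I.hab.symm]

/-- The fibre element at `c`. [folklore] -/
theorem Lof_c (x : σ →₀ ℕ) (k : ℕ) : Lof I x k I.c = x I.c - k := by
  classical simp [Lof, I.hac.symm, I.hbc.symm]

/-- The fibre element elsewhere. [folklore] -/
theorem Lof_other (x : σ →₀ ℕ) (k : ℕ) (j : σ) (ha : j ≠ I.a) (hb : j ≠ I.b) (hc : j ≠ I.c) : Lof I x k j = x j := by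
  classical simp [Lof, ha, hb, hc]

/-- The admissible range of `k = #α` in the fibre over `x`. [folklore] -/
def KR (x : σ →₀ ℕ) : Finset ℕ := Finset.range (min (x I.b) (x I.c) + 1)

omit [Fintype σ] [DecidableEq σ] in
/-- Membership in the admissible range. [folklore] -/
theorem mem_KR (x : σ →₀ ℕ) (k : ℕ) : k ∈ KR I x ↔ k ≤ x I.b ∧ k ≤ x I.c := by
  unfold KR; rw [Finset.mem_range, Nat.lt_succ_iff, le_min_iff]

/-- (F1) Every preimage of `x` is an `Lof x k` with `k` admissible (and `x a = 0`). [folklore] -/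
theorem eq_Lof_of_piT (L x : σ →₀ ℕ) (h : piT (frM I) L = x) :
    x I.a = 0 ∧ L I.a ∈ KR I x ∧ L = Lof I x (L I.a) := by
  have ha := piT_frM_a I L; have hb := piT_frM_b I L; have hc := piT_frM_c I L
  rw [h] at ha hb hc
  refine ⟨ha, (mem_KR I x _).2 ⟨by omega, by omega⟩, ?_⟩
  ext j
  by_cases hja : j = I.a
  · subst hja; rw [Lof_a]
  by_cases hjb : j = I.b
  · subst hjb; rw [Lof_b]; omega
  by_cases hjc : j = I.c
  · subst hjc; rw [Lof_c]; omega
  rw [Lof_other I x _ j hja hjb hjc, ← h, piT_frM_other I L j hja hjb hjc]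

/-- (F2) Every admissible `Lof x k` lies in the fibre over `x` (when `x a = 0`). [folklore] -/
theorem piT_Lof (x : σ →₀ ℕ) (hx : x I.a = 0) (k : ℕ) (hk : k ∈ KR I x) : piT (frM I) (Lof I x k) = x := by
  rw [mem_KR] at hk
  ext j
  by_cases hja : j = I.a
  · subst hja; rw [piT_frM_a, hx]
  by_cases hjb : j = I.b
  · subst hjb; rw [piT_frM_b, Lof_a, Lof_b]; omega
  by_cases hjc : j = I.c
  · subst hjc; rw [piT_frM_c, Lof_a, Lof_c]; omega
  rw [piT_frM_other I _ j hja hjb hjc, Lof_other I x k j hja hjb hjc]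

/-- The degree of the reduced exponent. [folklore] -/
theorem deg_xhat (x : σ →₀ ℕ) : deg (xhat I x) = (∑ j ∈ rest I, x j) + x I.b := by
  rw [deg_eq_sum, sum_three_split I, xhat_a, xhat_b, xhat_c, zero_add, add_zero]
  congr 1
  refine Finset.sum_congr rfl fun j hj => ?_
  rw [mem_rest] at hj
  rw [xhat_other I x j hj.1 hj.2.2]

/-- The full degree in terms of the reduced one. [folklore] -/
theorem deg_eq_deg_xhat_add (x : σ →₀ ℕ) : deg x = deg (xhat I x) + (x I.a + x I.c) := by
  rw [deg_xhat, deg_eq_sum, sum_three_split I]; ring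

/-- (F4) The degree along the fibre DROPS by `k`: `deg (Lof x k) + k = deg x̂ + x c`. [folklore] -/
theorem deg_Lof (x : σ →₀ ℕ) (k : ℕ) (hk : k ∈ KR I x) : deg (Lof I x k) + k = deg (xhat I x) + x I.c := by
  rw [mem_KR] at hk
  rw [deg_xhat, deg_eq_sum, sum_three_split I, Lof_a, Lof_b, Lof_c]
  have : ∑ j ∈ rest I, (Lof I x k) j = ∑ j ∈ rest I, x j := by
    refine Finset.sum_congr rfl fun j hj => ?_
    rw [mem_rest] at hj
    rw [Lof_other I x k j hj.1 hj.2.1 hj.2.2]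
  rw [this]; omega


/-- The slice normaliser `(deg x̂ - 1)! / (x_b! · ∏_rest x_j!)` (nonzero). [folklore] -/
def Pfac (x : σ →₀ ℕ) : ℂ :=
  (((deg (xhat I x) - 1).factorial : ℕ) : ℂ) / ((((x I.b).factorial * ∏ j ∈ rest I, (x j).factorial : ℕ)) : ℂ)

/-- The slice normaliser is nonzero. [folklore] -/
theorem Pfac_ne_zero (x : σ →₀ ℕ) : Pfac I x ≠ 0 := by
  unfold Pfac
  refine div_ne_zero (Nat.cast_ne_zero.mpr (Nat.factorial_ne_zero _)) (Nat.cast_ne_zero.mpr ?_)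
  exact Nat.mul_ne_zero (Nat.factorial_ne_zero _) (Finset.prod_ne_zero_iff.mpr fun j _ => Nat.factorial_ne_zero _)

/-- (F5) **Multinomial regrouping along the fibre** (varying letter count):
`multinomial(L_k) / deg(L_k) = Pfac(x) · C(x_b, k) · C(deg x̂ + x_c - 1 - k, x_c - k)` for non-exceptional `x` (`deg x̂ ≥ 1`). [folklore] -/
theorem multinomial_Lof_div (x : σ →₀ ℕ) (k : ℕ) (hk : k ∈ KR I x) (h1 : 1 ≤ deg (xhat I x)) :
    ((Lof I x k).multinomial : ℂ) / ((deg (Lof I x k) : ℕ) : ℂ) =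
      Pfac I x * (((x I.b).choose k * (deg (xhat I x) + x I.c - 1 - k).choose (x I.c - k) : ℕ) : ℂ) := by
  have hk' := (mem_KR I x k).1 hk
  have hdeg := deg_Lof I x k hk
  set D := deg (xhat I x) with hD
  set n := deg (Lof I x k) with hn
  have sL := Nat.multinomial_spec (Finset.univ : Finset σ) (Lof I x k)
  rw [← multinomial_univ, ← deg_eq_sum] at sL
  rw [prod_three_split I, Lof_a, Lof_b, Lof_c] at sL
  have hr : ∏ j ∈ rest I, ((Lof I x k) j).factorial = ∏ j ∈ rest I, (x j).factorial := by
    refine Finset.prod_congr rfl fun j hj => ?_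
    rw [mem_rest] at hj
    rw [Lof_other I x k j hj.1 hj.2.1 hj.2.2]
  rw [hr, ← hn] at sL
  -- factorial identities
  have h1 : (x I.b).choose k * k.factorial * (x I.b - k).factorial = (x I.b).factorial :=
    Nat.choose_mul_factorial_mul_factorial hk'.1
  have h2 : (D + x I.c - 1 - k).choose (x I.c - k) * (x I.c - k).factorial * (D - 1).factorial =
      (D + x I.c - 1 - k).factorial := by
    have := Nat.choose_mul_factorial_mul_factorial (n := D + x I.c - 1 - k) (k := x I.c - k) (by omega)
    rwa [show D + x I.c - 1 - k - (x I.c - k) = D - 1 by omega] at this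
  have h3 : n.factorial = n * (D + x I.c - 1 - k).factorial := by
    rw [show n = (D + x I.c - 1 - k) + 1 by omega, Nat.factorial_succ]
  have hn0 : (n : ℂ) ≠ 0 := Nat.cast_ne_zero.mpr (by omega)
  have hden : ((((x I.b).factorial * ∏ j ∈ rest I, (x j).factorial : ℕ)) : ℂ) ≠ 0 :=
    Nat.cast_ne_zero.mpr (Nat.mul_ne_zero (Nat.factorial_ne_zero _)
      (Finset.prod_ne_zero_iff.mpr fun j _ => Nat.factorial_ne_zero _))
  have hbk : (((x I.c - k).factorial : ℕ) : ℂ) ≠ 0 := Nat.cast_ne_zero.mpr (Nat.factorial_ne_zero _)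
  have key : ((Lof I x k).multinomial : ℂ) * ((∏ j ∈ rest I, (((x j).factorial : ℕ) : ℂ)) *
      ((k.factorial : ℂ) * ((((x I.b - k).factorial : ℕ) : ℂ) * (((x I.c - k).factorial : ℕ) : ℂ)))) =
      (n : ℂ) * ((((D + x I.c - 1 - k).choose (x I.c - k) : ℕ) : ℂ) * (((x I.c - k).factorial : ℕ) : ℂ) *
        (((D - 1).factorial : ℕ) : ℂ)) := by
    have e : ((((∏ j ∈ rest I, (x j).factorial) * (k.factorial * ((x I.b - k).factorial * (x I.c - k).factorial)) *
        (Lof I x k).multinomial : ℕ)) : ℂ) = ((n.factorial : ℕ) : ℂ) := by exact_mod_cast sL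
    rw [h3, ← h2] at e
    push_cast at e
    linear_combination e
  unfold Pfac
  rw [div_mul_eq_mul_div, div_eq_div_iff hn0 hden]
  have e1 : (((x I.b).factorial : ℕ) : ℂ) = (((x I.b).choose k : ℕ) : ℂ) * (k.factorial : ℂ) * (((x I.b - k).factorial : ℕ) : ℂ) := by
    exact_mod_cast h1.symm
  push_cast
  rw [e1]
  apply mul_right_cancel₀ hbk
  linear_combination ((((x I.b).choose k : ℕ) : ℂ)) * key


/-- Fibre sums of the free substitution: `coeff_x (φ_M H) = Σ_{k ∈ KR x} coeff_{L_k} H` (for `x a = 0`). [folklore] -/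
theorem coeff_phiT_frM (H : MvPolynomial σ ℂ) (x : σ →₀ ℕ) (hx : x I.a = 0) :
    coeff x (phiT (frM I) H) = ∑ k ∈ KR I x, coeff (Lof I x k) H := by
  classical
  rw [coeff_phiT]
  rw [← Finset.sum_filter_add_sum_filter_not (KR I x) (fun k => Lof I x k ∈ H.support)]
  rw [Finset.sum_eq_zero (s := (KR I x).filter fun k => ¬ Lof I x k ∈ H.support)
    (fun k hk => notMem_support_iff.mp (Finset.mem_filter.mp hk).2), add_zero]
  apply Finset.sum_nbij' (fun L => L I.a) (fun k => Lof I x k)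
  · intro L hL
    rw [Finset.mem_filter] at hL
    obtain ⟨-, hk, hLeq⟩ := eq_Lof_of_piT I L x hL.2
    rw [Finset.mem_filter, ← hLeq]
    exact ⟨hk, hL.1⟩
  · intro k hk
    rw [Finset.mem_filter] at hk
    rw [Finset.mem_filter]
    exact ⟨hk.2, piT_Lof I x hx k hk.1⟩
  · intro L hL
    rw [Finset.mem_filter] at hL
    exact (eq_Lof_of_piT I L x hL.2).2.2.symm
  · intro k _
    exact Lof_a I x k
  · intro L hL
    rw [Finset.mem_filter] at hL
    obtain ⟨-, -, hLeq⟩ := eq_Lof_of_piT I L x hL.2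
    rw [← hLeq]


end R6b
end Summit.ValiantsHypothesis.ValiantsHypothesis.Theorems.NewtonUnitEquations.TwoProducts.PermutationType

end
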